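import Summits.QuantumFields.YangMills.Theorems.ColdStartUniversalityLatticeLangevinMartingaleIncrements
import Summits.QuantumFields.YangMills.Theorems.ColdStartUniversalityLatticeLangevinTimeDecorrelation
import Summits.QuantumFields.YangMills.Theorems.ColdStartUniversalityLatticeLangevinCocycleMain
import HarnessLib

/-!
# Route `ColdStartUniversality` (fixed-cut-off SZZ dynamics): ★★★ HOEFFDING'S INEQUALITY FOR DISCRETE SAMPLES OF THE COLD-START SAMPLER —
# `P[|N⁻¹ Σ_(k<N) G(U_(kh)) − μ_(β')(G)| ≥ ε] ≤ 2·exp(−N ε²/(32 g²))`, `g = max(1, C/(1 − e^(−ch)))`, every bounded measurable `G`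

Helper file (seat `ym-line-csu-p1`, g34; `--supports stmt-QuantumFields-24809`).  The discrete-time companion of file 70 (what a simulation actually
computes: the empirical mean of `G` along the `h`-skeleton `U_0, U_h, U_(2h), …`).  File 54 gave the mean-square bound `O(1/N)` and the a.s. law of large
numbers; here the deviation probabilities are EXPONENTIALLY small in `N`: there are `C, c > 0` (`L, β'` only; Harris constants of `exp_mixing_szz`) such
that for EVERY strong solution of the SU(2) SZZ dynamics from a deterministic start on ANY probability space, every bounded measurable `G` with `|G| ≤ 1`,
every step `h > 0`, every `N` and every `ε > 0`,

  `P[ |N⁻¹ Σ_(k<N) G(U_(kh)) − ∫ G dμ_(β')| ≥ ε ] ≤ 2 · exp(−N ε² / (32 g²))`,   `g = max(1, C/(1 − e^(−ch)))`     (`measureReal_average_deviation_le_exp`).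

Proof (Glynn–Ormoneit for the uniformly ergodic skeleton chain, with a FINITE-HORIZON Poisson sum so that only finite sums occur): for
`Ĝ = G − μ(G)` and `ĝ_M = Σ_(j<M) κ_(jh) Ĝ` one has `|ĝ_M| ≤ g` (every-start exponential mixing, kernel form `abs_transition_sub_wilson_le_exp`) and
`ĝ_M − κ_h ĝ_M = Ĝ − κ_(Mh) Ĝ` (Chapman–Kolmogorov `chapmanKolmogorov_szz`, telescoping); the increments `D_k = ĝ_M(U_((k+1)h)) − (κ_h ĝ_M)(U_(kh))` are
bounded by `2g`, adapted, and orthogonal to every bounded `𝓕^W_(kh)`-measurable weight (Markov property, file 44), and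
`Σ_(k<N) Ĝ(U_(kh)) = Σ_(k<N) D_k − ĝ_M(U_(Nh)) + ĝ_M(x) + Σ_(k<N) (κ_(Mh)Ĝ)(U_(kh))` with the last sum `≤ N C e^(−cMh) ≤ g` for `M` large; file 68
(`measureReal_abs_sum_ge_le_of_orthogonal`) concludes.  No path regularity is needed (finitely many sampling times), so the bound holds for every
solution directly.  [cite: GlynnOrmoneit2002, Theorem 2].  THEOREMS ONLY, no definition, no sorry.  HONEST FRAMING: fixed cut-off, constants depend on
`L, β'` (and `h`); `UniformColdStartMixing` (24809) is NOT restated; no crux, rung or summit statement is proved; the Yang–Mills mass gap is NOT proved.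
-/

set_option autoImplicit false

noncomputable section

namespace Summit.QuantumFields.YangMills.Theorems.ColdStartUniversality

open MeasureTheory ProbabilityTheory Filter Topology Set
open scoped NNReal ENNReal BigOperators
open Literature Literature.Probability.Process Literature.MathematicalPhysics.QuantumFieldTheory
open Literature.MathematicalPhysics.QuantumLattice (fundamentalRep fundamentalLatticeRep continuous_fundamentalRep)

variable {L : ℕ} [NeZero L]

/-- ★★★ **HOEFFDING'S INEQUALITY FOR DISCRETE SAMPLES OF THE COLD-START LANGEVIN SAMPLER** (every coupling, every start, every realisation,
every bounded measurable observable; `C, c` depend on `L, β'`): there are `C, c > 0` such that for EVERY strong solution `U` of the SU(2) SZZ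
dynamics from a deterministic start on ANY probability space, every measurable `G` with `|G| ≤ 1`, every sampling step `h > 0`, every `N : ℕ` and
every `ε > 0`, with `g = max(1, C/(1 − e^(−ch)))`:
`P[ |N⁻¹ Σ_(k<N) G(U_(kh)) − ∫ G dμ_(β')| ≥ ε ] ≤ 2 · exp(−N·ε² / (32·g²))`. [cite: GlynnOrmoneit2002, Theorem 2] -/
theorem measureReal_average_deviation_le_exp (L : ℕ) [NeZero L] (β' : ℝ) :
    ∃ C c : ℝ, 0 < C ∧ 0 < c ∧
      ∀ (x : GaugeConfig 3 L (Matrix.specialUnitaryGroup (Fin 2) ℂ))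
        (Ω : Type) [MeasurableSpace Ω] (P : Measure Ω) [IsProbabilityMeasure P]
        (W : ℝ≥0 → Ω → (Edge 3 L × NoiseIdx 2 → ℝ)) (hW : IsFlatBrownian W P)
        (U : ℝ≥0 → Ω → GaugeConfig 3 L (Matrix.specialUnitaryGroup (Fin 2) ℂ)),
        (∀ ω, U 0 ω = x) →
        (latticeLangevinDynamics (fundamentalLatticeRep 2) β').IsSolution (fundamentalRep (Fin 2)) hW.natFiltration P W U →
        ∀ (G : GaugeConfig 3 L (Matrix.specialUnitaryGroup (Fin 2) ℂ) → ℝ), Measurable G → (∀ z, |G z| ≤ 1) →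
        ∀ (h : ℝ≥0), 0 < h → ∀ (N : ℕ) (ε : ℝ), 0 < ε →
          P.real {ω | ε ≤ |(N : ℝ)⁻¹ * (∑ k ∈ Finset.range N, G (U ((k : ℝ≥0) * h) ω)) -
              ∫ z, G z ∂(wilsonMeasure (d := 3) (L := L) (fundamentalRep (Fin 2)) β')|} ≤
            2 * Real.exp (-(N * ε ^ 2) / (32 * max 1 (C / (1 - Real.exp (-c * h))) ^ 2)) := by
  classical
  haveI := secondCountableTopology_su2
  haveI := borelSpace_config L
  obtain ⟨C, c, hC, hc, hmix⟩ := abs_transition_sub_wilson_le_exp L β'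
  refine ⟨C, c, hC, hc, fun x Ω _ P _ W hW U hU0 hU G hG hG1 h hh N ε hε => ?_⟩
  haveI : IsProbabilityMeasure (wilsonMeasure (d := 3) (L := L) (fundamentalRep (Fin 2)) β') :=
    isProbabilityMeasure_wilsonMeasure (d := 3) (L := L) (fundamentalRep (Fin 2)) (continuous_fundamentalRep (Fin 2)) β'
  set m : ℝ := ∫ z, G z ∂(wilsonMeasure (d := 3) (L := L) (fundamentalRep (Fin 2)) β') with hm
  have hm1 : |m| ≤ 1 := by
    have hh' := norm_integral_le_of_norm_le_const (μ := wilsonMeasure (d := 3) (L := L) (fundamentalRep (Fin 2)) β') (f := G) (C := 1)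
      (Eventually.of_forall fun z => by simpa [Real.norm_eq_abs] using hG1 z)
    simpa [Real.norm_eq_abs] using hh'
  -- the constants `ρ = e^(−ch) ∈ (0,1)` and `g = max(1, C/(1−ρ))`
  set ρ : ℝ := Real.exp (-c * h) with hρ
  have hρ0 : 0 < ρ := Real.exp_pos _
  have hρ1 : ρ < 1 := Real.exp_lt_one_iff.2 (by have : (0 : ℝ) < h := hh; nlinarith)
  set g : ℝ := max 1 (C / (1 - Real.exp (-c * h))) with hg
  have hg1 : 1 ≤ g := le_max_left _ _
  have hgC : C / (1 - ρ) ≤ g := le_max_right _ _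
  have hg0 : 0 < g := one_pos.trans_le hg1
  have hmU : ∀ s : ℝ≥0, Measurable (U s) := fun s => (hU.adapted s).mono (hW.natFiltration.le s) le_rfl
  /- ### 0. Trivial regimes: `N = 0`, or `ε > 2` -/
  have hRHS1 : ∀ {y : ℝ}, y ≤ 3 / 8 → (1 : ℝ) ≤ 2 * Real.exp (-y) := fun {y} hy => by
    have h1 := Real.add_one_le_exp (-y)
    linarith
  rcases Nat.eq_zero_or_pos N with hN0 | hNpos
  · subst hN0
    refine measureReal_le_one.trans ?_
    rw [Nat.cast_zero, zero_mul, neg_zero, zero_div, Real.exp_zero]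
    norm_num
  have hNr : (0 : ℝ) < N := by exact_mod_cast hNpos
  have havg : ∀ ω, |(N : ℝ)⁻¹ * ∑ k ∈ Finset.range N, G (U ((k : ℝ≥0) * h) ω)| ≤ 1 := fun ω => by
    rw [abs_mul, abs_inv, abs_of_pos hNr]
    have h1 : |∑ k ∈ Finset.range N, G (U ((k : ℝ≥0) * h) ω)| ≤ N := (Finset.abs_sum_le_sum_abs _ _).trans (by
      calc ∑ k ∈ Finset.range N, |G (U ((k : ℝ≥0) * h) ω)| ≤ ∑ _k ∈ Finset.range N, (1 : ℝ) := Finset.sum_le_sum fun k _ => hG1 _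
        _ = N := by simp)
    calc (N : ℝ)⁻¹ * |∑ k ∈ Finset.range N, G (U ((k : ℝ≥0) * h) ω)| ≤ (N : ℝ)⁻¹ * N := mul_le_mul_of_nonneg_left h1 (inv_nonneg.2 hNr.le)
      _ = 1 := inv_mul_cancel₀ hNr.ne'
  by_cases hε2 : 2 < ε
  · have hempty : {ω | ε ≤ |(N : ℝ)⁻¹ * (∑ k ∈ Finset.range N, G (U ((k : ℝ≥0) * h) ω)) - m|} = ∅ := by
      refine Set.eq_empty_iff_forall_notMem.2 fun ω hω => ?_
      simp only [Set.mem_setOf_eq] at hω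
      have h3 : |(N : ℝ)⁻¹ * (∑ k ∈ Finset.range N, G (U ((k : ℝ≥0) * h) ω)) - m| ≤ 2 := (abs_sub _ _).trans (by linarith [havg ω, hm1])
      linarith
    rw [hempty, measureReal_empty]
    positivity
  push Not at hε2
  /- ### 1. Realising kernels, the centred observable, the kernel actions `a_j = κ_(jh) Ĝ` -/
  obtain ⟨κ, hκM, hκ0, hreal⟩ := exists_transitionKernel L β'
  haveI := hκM
  set Gh : GaugeConfig 3 L (Matrix.specialUnitaryGroup (Fin 2) ℂ) → ℝ := fun z => G z - m with hGh
  have hGhm : Measurable Gh := hG.sub measurable_const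
  have hGhb : ∀ z, |Gh z| ≤ 2 := fun z => (abs_sub _ _).trans (by linarith [hG1 z, hm1])
  set a : ℕ → GaugeConfig 3 L (Matrix.specialUnitaryGroup (Fin 2) ℂ) → ℝ := fun j y => ∫ z, Gh z ∂(κ ((j : ℝ≥0) * h) y) with ha
  have ham : ∀ j, Measurable (a j) := fun j => (hGhm.stronglyMeasurable.integral_kernel (κ := κ ((j : ℝ≥0) * h))).measurable
  have hGi : ∀ (ν : Measure (GaugeConfig 3 L (Matrix.specialUnitaryGroup (Fin 2) ℂ))) [IsProbabilityMeasure ν], Integrable G ν := fun ν _ =>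
    (integrable_const (1 : ℝ)).mono' hG.aestronglyMeasurable (Eventually.of_forall fun z => by simpa [Real.norm_eq_abs] using hG1 z)
  have ha_eq : ∀ j y, a j y = (∫ z, G z ∂(κ ((j : ℝ≥0) * h) y)) - m := fun j y => by
    simp only [ha, hGh]
    rw [integral_sub (hGi _) (integrable_const m), integral_const, smul_eq_mul, probReal_univ, one_mul]
  have hab : ∀ j y, |a j y| ≤ C * ρ ^ j := fun j y => by
    rw [ha_eq, hρ, ← Real.exp_nat_mul]
    have h1 := hmix κ hreal G hG hG1 ((j : ℝ≥0) * h) y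
    have h2 : -c * (((j : ℝ≥0) * h : ℝ≥0) : ℝ) = j * (-c * h) := by push_cast; ring
    rwa [h2] at h1
  /- ### 2. The horizon `M` and the finite Poisson sum `ĝ_M = Σ_(j<M) a_j` -/
  obtain ⟨M, hM⟩ := exists_pow_lt_of_lt_one (show 0 < g / (N * C + 1) by positivity) hρ1
  have hMb : (N : ℝ) * (C * ρ ^ M) ≤ g := by
    have h1 : (N * C + 1) * ρ ^ M ≤ g := by
      have := (lt_div_iff₀ (by positivity : (0 : ℝ) < N * C + 1)).1 hM
      linarith [mul_comm (ρ ^ M) ((N : ℝ) * C + 1)]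
    nlinarith [pow_nonneg hρ0.le M]
  set gM : GaugeConfig 3 L (Matrix.specialUnitaryGroup (Fin 2) ℂ) → ℝ := fun y => ∑ j ∈ Finset.range M, a j y with hgM
  have hgMm : Measurable gM := Finset.measurable_sum _ fun j _ => ham j
  have hgeom : ∑ j ∈ Finset.range M, ρ ^ j ≤ 1 / (1 - ρ) := by
    rw [le_div_iff₀ (by linarith), geom_sum_mul_neg]
    linarith [pow_nonneg hρ0.le M]
  have hgMb : ∀ y, |gM y| ≤ g := fun y => by
    calc |gM y| ≤ ∑ j ∈ Finset.range M, |a j y| := Finset.abs_sum_le_sum_abs _ _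
      _ ≤ ∑ j ∈ Finset.range M, C * ρ ^ j := Finset.sum_le_sum fun j _ => hab j y
      _ = C * ∑ j ∈ Finset.range M, ρ ^ j := by rw [Finset.mul_sum]
      _ ≤ C * (1 / (1 - ρ)) := mul_le_mul_of_nonneg_left hgeom hC.le
      _ = C / (1 - ρ) := by ring
      _ ≤ g := hgC
  -- `κ_h ĝ_M = Σ_(j<M) a_(j+1)` (Chapman–Kolmogorov)
  have hai : ∀ j (ν : Measure (GaugeConfig 3 L (Matrix.specialUnitaryGroup (Fin 2) ℂ))) [IsProbabilityMeasure ν], Integrable (a j) ν :=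
    fun j ν _ => (integrable_const (C * ρ ^ j)).mono' (ham j).aestronglyMeasurable
      (Eventually.of_forall fun z => by rw [Real.norm_eq_abs]; exact hab j z)
  have hκgM : ∀ y, ∫ z, gM z ∂(κ h y) = ∑ j ∈ Finset.range M, a (j + 1) y := by
    intro y
    simp only [hgM]
    rw [integral_finsetSum _ fun j _ => hai j _]
    refine Finset.sum_congr rfl fun j _ => ?_
    have hck := chapmanKolmogorov_szz β' κ hreal h ((j : ℝ≥0) * h)
    have heq : (((j + 1 : ℕ) : ℝ≥0) * h) = h + (j : ℝ≥0) * h := by push_cast; ring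
    have hGhi : Integrable Gh ((κ ((j : ℝ≥0) * h) ∘ₖ κ h) y) := by
      haveI : IsProbabilityMeasure ((κ ((j : ℝ≥0) * h) ∘ₖ κ h) y) := by rw [← hck]; infer_instance
      exact (integrable_const (2 : ℝ)).mono' hGhm.aestronglyMeasurable (Eventually.of_forall fun z => by
        rw [Real.norm_eq_abs]; exact hGhb z)
    show ∫ z, a j z ∂(κ h y) = ∫ z, Gh z ∂(κ (((j + 1 : ℕ) : ℝ≥0) * h) y)
    rw [heq, hck, Kernel.integral_comp hGhi]
  -- the finite-horizon Poisson relation `ĝ_M − κ_h ĝ_M = Ĝ − a_M`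
  have hPois : ∀ y, gM y - ∫ z, gM z ∂(κ h y) = Gh y - a M y := by
    intro y
    have ha0 : a 0 y = Gh y := by
      simp only [ha, Nat.cast_zero, zero_mul, hκ0, Kernel.id_apply]
      exact integral_dirac' _ _ hGhm.stronglyMeasurable
    rw [hκgM, hgM, ← Finset.sum_sub_distrib, Finset.sum_range_sub', ha0]
  /- ### 3. The increments `D_k = ĝ_M(U_((k+1)h)) − (κ_h ĝ_M)(U_(kh))` -/
  have hκgMm : Measurable fun y => ∫ z, gM z ∂(κ h y) := (hgMm.stronglyMeasurable.integral_kernel (κ := κ h)).measurable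
  have hκgMb : ∀ y, |∫ z, gM z ∂(κ h y)| ≤ g := fun y => by
    have hh' := norm_integral_le_of_norm_le_const (μ := κ h y) (f := gM) (C := g)
      (Eventually.of_forall fun z => by simpa [Real.norm_eq_abs] using hgMb z)
    simpa [Real.norm_eq_abs] using hh'
  set D : ℕ → Ω → ℝ := fun k ω =>
    gM (U (((k + 1 : ℕ) : ℝ≥0) * h) ω) - ∫ z, gM z ∂(κ h (U ((k : ℝ≥0) * h) ω)) with hD
  have hkh : ∀ j k : ℕ, j ≤ k → (j : ℝ≥0) * h ≤ (k : ℝ≥0) * h := fun j k hjk =>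
    mul_le_mul_of_nonneg_right (by exact_mod_cast hjk) h.2
  have hDF : ∀ k, Measurable[hW.natFiltration (((k + 1 : ℕ) : ℝ≥0) * h)] (D k) := fun k =>
    (hgMm.comp (hU.adapted _)).sub ((hκgMm.comp (hU.adapted _)).mono (hW.natFiltration.mono (hkh k (k + 1) (Nat.le_succ k))) le_rfl)
  have hDm : ∀ k, Measurable (D k) := fun k => (hDF k).mono (hW.natFiltration.le _) le_rfl
  set B : ℝ := 2 * g with hB
  have hB0 : 0 < B := by positivity
  have hDb : ∀ k ω, |D k ω| ≤ B := fun k ω => by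
    simp only [hD, hB]
    exact (abs_sub _ _).trans (by linarith [hgMb (U (((k + 1 : ℕ) : ℝ≥0) * h) ω), hκgMb (U ((k : ℝ≥0) * h) ω)])
  /- ### 4. Orthogonality (Markov property, file 44) -/
  have horth : ∀ k < N, ∀ l : ℝ, ∫ ω, Real.exp (l * ∑ j ∈ Finset.range k, D j ω) * D k ω ∂P = 0 := by
    intro k _ l
    set Z : Ω → ℝ := fun ω => Real.exp (l * ∑ j ∈ Finset.range k, D j ω) with hZ
    have hSF : Measurable[hW.natFiltration ((k : ℝ≥0) * h)] fun ω => ∑ j ∈ Finset.range k, D j ω := by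
      refine Finset.measurable_sum (Finset.range k) fun j hj => ?_
      exact (hDF j).mono (hW.natFiltration.mono (hkh (j + 1) k (Nat.succ_le_of_lt (Finset.mem_range.1 hj)))) le_rfl
    have hZF : Measurable[hW.natFiltration ((k : ℝ≥0) * h)] Z := (hSF.const_mul l).exp
    have hZm : Measurable Z := hZF.mono (hW.natFiltration.le _) le_rfl
    have hSb : ∀ ω, |∑ j ∈ Finset.range k, D j ω| ≤ k * B := fun ω =>
      (Finset.abs_sum_le_sum_abs _ _).trans (by
        calc ∑ j ∈ Finset.range k, |D j ω| ≤ ∑ _j ∈ Finset.range k, B := Finset.sum_le_sum fun j _ => hDb j ω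
          _ = k * B := by rw [Finset.sum_const, Finset.card_range, nsmul_eq_mul])
    have hZb : ∀ ω, |Z ω| ≤ Real.exp (|l| * (k * B)) := fun ω => by
      rw [hZ, abs_of_pos (Real.exp_pos _), Real.exp_le_exp]
      calc l * ∑ j ∈ Finset.range k, D j ω ≤ |l * ∑ j ∈ Finset.range k, D j ω| := le_abs_self _
        _ = |l| * |∑ j ∈ Finset.range k, D j ω| := abs_mul _ _
        _ ≤ |l| * (k * B) := mul_le_mul_of_nonneg_left (hSb ω) (abs_nonneg l)
    have e1 : ∫ ω, Z ω * gM (U (((k + 1 : ℕ) : ℝ≥0) * h) ω) ∂P = ∫ ω, Z ω * (∫ z, gM z ∂(κ h (U ((k : ℝ≥0) * h) ω))) ∂P := by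
      have ht : (((k + 1 : ℕ) : ℝ≥0) * h) = (k : ℝ≥0) * h + h := by push_cast; ring
      rw [ht]
      exact integral_mul_comp_add_eq_integral_mul_transition β' κ hreal x hW hU0 hU ((k : ℝ≥0) * h) h hZF hZb hgMm hgMb
    have hInt : ∀ {φ : Ω → ℝ} {Cφ : ℝ}, Measurable φ → (∀ ω, |φ ω| ≤ Cφ) → Integrable (fun ω => Z ω * φ ω) P :=
      fun {φ Cφ} hφ hφb => (integrable_const (Real.exp (|l| * (k * B)) * Cφ)).mono' (hZm.mul hφ).aestronglyMeasurable
        (Eventually.of_forall fun ω => by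
          rw [norm_mul, Real.norm_eq_abs, Real.norm_eq_abs]
          exact mul_le_mul (hZb ω) (hφb ω) (abs_nonneg _) (Real.exp_pos _).le)
    have i1 : Integrable (fun ω => Z ω * gM (U (((k + 1 : ℕ) : ℝ≥0) * h) ω)) P := hInt (hgMm.comp (hmU _)) fun ω => hgMb _
    have i2 : Integrable (fun ω => Z ω * ∫ z, gM z ∂(κ h (U ((k : ℝ≥0) * h) ω))) P := hInt (hκgMm.comp (hmU _)) fun ω => hκgMb _
    have hpt : ∀ ω, Z ω * D k ω = Z ω * gM (U (((k + 1 : ℕ) : ℝ≥0) * h) ω) - Z ω * ∫ z, gM z ∂(κ h (U ((k : ℝ≥0) * h) ω)) :=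
      fun ω => by simp only [hD]; ring
    rw [integral_congr_ae (ae_of_all _ hpt), integral_sub i1 i2, e1, sub_self]
  /- ### 5. Azuma–Hoeffding (file 68), telescoping, event inclusion -/
  have htail : ∀ {r : ℝ}, 0 ≤ r → P.real {ω | r ≤ |∑ j ∈ Finset.range N, D j ω|} ≤ 2 * Real.exp (-r ^ 2 / (2 * (N * B ^ 2))) :=
    fun {r} hr => measureReal_abs_sum_ge_le_of_orthogonal D hDm hB0 hDb N horth hr
  have hsum : ∀ ω, ∑ j ∈ Finset.range N, D j ω = gM (U ((N : ℝ≥0) * h) ω) - gM (U (((0 : ℕ) : ℝ≥0) * h) ω) +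
      ((∑ j ∈ Finset.range N, Gh (U ((j : ℝ≥0) * h) ω)) - ∑ j ∈ Finset.range N, a M (U ((j : ℝ≥0) * h) ω)) := by
    intro ω
    have h1 : ∀ j, D j ω = (gM (U (((j + 1 : ℕ) : ℝ≥0) * h) ω) - gM (U ((j : ℝ≥0) * h) ω)) +
        (gM (U ((j : ℝ≥0) * h) ω) - ∫ z, gM z ∂(κ h (U ((j : ℝ≥0) * h) ω))) := fun j => by simp only [hD]; ring
    rw [Finset.sum_congr rfl fun j _ => h1 j, Finset.sum_add_distrib,
      Finset.sum_range_sub (fun j => gM (U ((j : ℝ≥0) * h) ω)) N]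
    congr 1
    exact (Finset.sum_congr rfl fun j _ => hPois _).trans
      (Finset.sum_sub_distrib (fun j : ℕ => Gh (U ((j : ℝ≥0) * h) ω)) (fun j : ℕ => a M (U ((j : ℝ≥0) * h) ω)))
  have hU0' : ∀ ω, U (((0 : ℕ) : ℝ≥0) * h) ω = x := fun ω => by rw [Nat.cast_zero, zero_mul]; exact hU0 ω
  have hcent : ∀ ω, (N : ℝ)⁻¹ * (∑ k ∈ Finset.range N, G (U ((k : ℝ≥0) * h) ω)) - m =
      (N : ℝ)⁻¹ * ∑ k ∈ Finset.range N, Gh (U ((k : ℝ≥0) * h) ω) := fun ω => by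
    simp only [hGh, Finset.sum_sub_distrib, Finset.sum_const, Finset.card_range, nsmul_eq_mul, mul_sub]
    rw [← mul_assoc, inv_mul_cancel₀ hNr.ne', one_mul]
  have hrem : ∀ ω, |∑ j ∈ Finset.range N, a M (U ((j : ℝ≥0) * h) ω)| ≤ g := fun ω =>
    (Finset.abs_sum_le_sum_abs _ _).trans ((Finset.sum_le_sum fun j _ => hab M _).trans (by
      rw [Finset.sum_const, Finset.card_range, nsmul_eq_mul]; exact hMb))
  have hincl : {ω | ε ≤ |(N : ℝ)⁻¹ * (∑ k ∈ Finset.range N, G (U ((k : ℝ≥0) * h) ω)) - m|} ⊆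
      {ω | N * ε - 3 * g ≤ |∑ j ∈ Finset.range N, D j ω|} := by
    intro ω hω
    simp only [Set.mem_setOf_eq] at hω ⊢
    rw [hcent ω, abs_mul, abs_inv, abs_of_pos hNr] at hω
    have hNI : (N : ℝ) * ε ≤ |∑ k ∈ Finset.range N, Gh (U ((k : ℝ≥0) * h) ω)| := by
      have := mul_le_mul_of_nonneg_left hω hNr.le
      rwa [← mul_assoc, mul_inv_cancel₀ hNr.ne', one_mul] at this
    have hI : ∑ k ∈ Finset.range N, Gh (U ((k : ℝ≥0) * h) ω) = (∑ j ∈ Finset.range N, D j ω) -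
        (gM (U ((N : ℝ≥0) * h) ω) - gM (U (((0 : ℕ) : ℝ≥0) * h) ω)) + ∑ j ∈ Finset.range N, a M (U ((j : ℝ≥0) * h) ω) := by
      rw [hsum ω]; ring
    rw [hI] at hNI
    have h1 := abs_add_le ((∑ j ∈ Finset.range N, D j ω) - (gM (U ((N : ℝ≥0) * h) ω) - gM (U (((0 : ℕ) : ℝ≥0) * h) ω)))
      (∑ j ∈ Finset.range N, a M (U ((j : ℝ≥0) * h) ω))
    have h2 := abs_sub (∑ j ∈ Finset.range N, D j ω) (gM (U ((N : ℝ≥0) * h) ω) - gM (U (((0 : ℕ) : ℝ≥0) * h) ω))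
    have h3 : |gM (U ((N : ℝ≥0) * h) ω) - gM (U (((0 : ℕ) : ℝ≥0) * h) ω)| ≤ 2 * g :=
      (abs_sub _ _).trans (by linarith [hgMb (U ((N : ℝ≥0) * h) ω), hgMb (U (((0 : ℕ) : ℝ≥0) * h) ω)])
    linarith [hrem ω]
  /- ### 6. Arithmetic -/
  by_cases hbig : 6 * g ≤ N * ε
  · have hr : 0 ≤ N * ε - 3 * g := by linarith
    refine (measureReal_mono hincl).trans ((htail hr).trans ?_)
    refine mul_le_mul_of_nonneg_left (Real.exp_le_exp.2 ?_) (by norm_num)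
    rw [neg_div, neg_div, neg_le_neg_iff]
    have hden0 : 0 < 2 * (N * B ^ 2) := by positivity
    have hnum : (N : ℝ) ^ 2 * ε ^ 2 / 4 ≤ (N * ε - 3 * g) ^ 2 := by nlinarith
    calc (N : ℝ) * ε ^ 2 / (32 * g ^ 2) = ((N : ℝ) ^ 2 * ε ^ 2 / 4) / (2 * (N * B ^ 2)) := by
          rw [hB, div_eq_div_iff (by positivity) (by positivity)]
          ring
      _ ≤ (N * ε - 3 * g) ^ 2 / (2 * (N * B ^ 2)) := div_le_div_of_nonneg_right hnum hden0.le
  · push Not at hbig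
    have hNε2 : (N : ℝ) * ε ^ 2 < 12 * g := by
      calc (N : ℝ) * ε ^ 2 = (N * ε) * ε := by ring
        _ ≤ (N * ε) * 2 := by gcongr
        _ < (6 * g) * 2 := by gcongr
        _ = 12 * g := by ring
    refine measureReal_le_one.trans ?_
    rw [neg_div]
    refine hRHS1 ?_
    rw [div_le_div_iff₀ (by positivity) (by norm_num)]
    nlinarith

end Summit.QuantumFields.YangMills.Theorems.ColdStartUniversality

end
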